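import Mathlib
import Literature.Analysis.FunctionSpaces.PlanarRieszKernelBounds
import HarnessLib

/-!
# The planar bathtub inequality `|A|² ≤ 2π ∫_A |z − x|²`

Analysis/FunctionSpaces theorem file (everything proved), on the Euclidean plane `ℝ² = EuclideanSpace ℝ (Fin 2)` with Lebesgue
measure: among planar sets of given area, the disc centred at `x` minimises the second moment about `x`
(bathtub principle, Lieb–Loss Thm 1.14, for the increasing radial weight `|z − x|²`), whence for every measurable `A`
of finite measure and every centre `x`

  `|A|² ≤ 2π ∫_A |z − x|² dz`      (`sq_volume_le_lintegral_norm_sq`, in `ℝ≥0∞`; real form `sq_volume_real_le_integral_norm_sq`),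

with equality for discs (`∫_{B(x,ρ)} |z − x|² = πρ⁴/2 = |B(x,ρ)|²/(2π)`, `lintegral_ball_norm_sq`).  Proof: the exchange lemma
`setLIntegral_le_of_level` of `PlanarRieszKernelBounds` applied to the truncated weight `2ρ² − min(|z−x|², 2ρ²)` (large on the disc,
small off it), and polar integration on discs (`setIntegral_ball_fun_norm_sub`).  This is the "planar bathtub `|A_z|² ≤ 2π∫_{A_z} r²`" step
of the hauling inequality (crux `PowerGaugeEulerLiouville`, line `casimir_haul`, stub H3), companion of the tree's three-dimensional tube
version `NeedleAxisymBand.sq_volume_le_integral_cylRadius_sq`.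

[cite: LiebLoss2001, Theorem 1.14 (bathtub principle)]
-/

noncomputable section

open MeasureTheory Set Filter Metric Function Module Real
open scoped ENNReal NNReal Topology

namespace Literature.Analysis.FunctionSpaces

section Disc

/-- **Second moment of a disc**: `∫_{B(x,ρ)} |z − x|² dz = πρ⁴/2` (`0 ≤ ρ`). [cite: LiebLoss2001, Theorem 1.14 (bathtub principle)] -/
theorem lintegral_ball_norm_sq {ρ : ℝ} (hρ : 0 ≤ ρ) (x : EuclideanSpace ℝ (Fin 2)) :
    ∫⁻ z in ball x ρ, ENNReal.ofReal (‖z - x‖ ^ 2) = ENNReal.ofReal (π * ρ ^ 4 / 2) := by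
  have hint1 : IntegrableOn (fun y : ℝ => y * y ^ 2) (Ioo 0 ρ) :=
    (continuous_id.mul (continuous_id.pow 2)).integrableOn_Icc.mono_set Ioo_subset_Icc_self
  have hint : IntegrableOn (fun z : EuclideanSpace ℝ (Fin 2) => ‖z - x‖ ^ 2) (ball x ρ) :=
    integrableOn_ball_fun_norm_sub (g := fun y => y ^ 2) hint1 x
  rw [← ofReal_integral_eq_lintegral_ofReal hint (Eventually.of_forall fun z => by positivity),
    setIntegral_ball_fun_norm_sub (fun y => y ^ 2) x ρ]
  congr 1
  have e : ∫ y in Ioo 0 ρ, y * y ^ 2 = ρ ^ 4 / 4 := by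
    rw [← integral_Ioc_eq_integral_Ioo, ← intervalIntegral.integral_of_le hρ,
      show (fun y : ℝ => y * y ^ 2) = fun y => y ^ 3 from funext fun y => by ring, integral_pow]
    norm_num
  rw [e]
  ring

/-- The area of a disc (real form): `|B(x,ρ)| = πρ²`. [cite: LiebLoss2001, Theorem 1.14 (bathtub principle)] -/
theorem volume_ball_fin_two_ofReal {ρ : ℝ} (hρ : 0 ≤ ρ) (x : EuclideanSpace ℝ (Fin 2)) :
    volume (ball x ρ) = ENNReal.ofReal (π * ρ ^ 2) := by
  rw [EuclideanSpace.volume_ball_fin_two, ← ENNReal.ofReal_pow hρ, ← ENNReal.ofReal_mul (by positivity), mul_comm]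

end Disc

section Bathtub

/-- **THE DISC MINIMISES THE SECOND MOMENT** (bathtub for the increasing weight `|z − x|²`): if `|A| = |B(x,ρ)|` then
`∫_{B(x,ρ)} |z−x|² ≤ ∫_A |z−x|²`. [cite: LiebLoss2001, Theorem 1.14 (bathtub principle)] -/
theorem lintegral_ball_norm_sq_le_of_volume_eq {A : Set (EuclideanSpace ℝ (Fin 2))} (hA : MeasurableSet A) {x : EuclideanSpace ℝ (Fin 2)}
    {ρ : ℝ} (hρ : 0 ≤ ρ) (hvol : volume A = volume (ball x ρ)) :
    ∫⁻ z in ball x ρ, ENNReal.ofReal (‖z - x‖ ^ 2) ≤ ∫⁻ z in A, ENNReal.ofReal (‖z - x‖ ^ 2) := by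
  have hBfin : volume (ball x ρ) ≠ ⊤ := measure_ball_lt_top.ne
  have hAfin : volume A ≠ ⊤ := by rw [hvol]; exact hBfin
  -- the truncated, reversed weight `h z = 2ρ² − min(|z−x|², 2ρ²)`: `≥ ρ²` on the disc, `≤ ρ²` off it
  set h : EuclideanSpace ℝ (Fin 2) → ℝ≥0∞ := fun z => ENNReal.ofReal (2 * ρ ^ 2 - min (‖z - x‖ ^ 2) (2 * ρ ^ 2)) with hh
  have hge : ∀ z ∈ ball x ρ, ENNReal.ofReal (ρ ^ 2) ≤ h z := by
    intro z hz
    have hzx : ‖z - x‖ < ρ := by rwa [mem_ball, dist_eq_norm] at hz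
    have h1 : ‖z - x‖ ^ 2 ≤ ρ ^ 2 := by
      exact pow_le_pow_left₀ (norm_nonneg _) hzx.le 2
    refine ENNReal.ofReal_le_ofReal ?_
    rw [min_eq_left (by nlinarith)]
    nlinarith
  have hle : ∀ z, z ∉ ball x ρ → h z ≤ ENNReal.ofReal (ρ ^ 2) := by
    intro z hz
    have hzx : ρ ≤ ‖z - x‖ := by rw [mem_ball, dist_eq_norm, not_lt] at hz; exact hz
    have h1 : ρ ^ 2 ≤ ‖z - x‖ ^ 2 := pow_le_pow_left₀ hρ hzx 2
    refine ENNReal.ofReal_le_ofReal ?_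
    have : ρ ^ 2 ≤ min (‖z - x‖ ^ 2) (2 * ρ ^ 2) := le_min h1 (by nlinarith)
    linarith
  have hex : ∫⁻ z in A, h z ≤ ∫⁻ z in ball x ρ, h z :=
    setLIntegral_le_of_level hA measurableSet_ball hvol hAfin hge hle
  -- unpack: `h = 2ρ² − min(·)` on both sides
  have hsplit : ∀ (S : Set (EuclideanSpace ℝ (Fin 2))), MeasurableSet S → volume S ≠ ⊤ →
      (∫⁻ z in S, h z) + ∫⁻ z in S, ENNReal.ofReal (min (‖z - x‖ ^ 2) (2 * ρ ^ 2)) = ENNReal.ofReal (2 * ρ ^ 2) * volume S := by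
    intro S hS hSfin
    rw [← lintegral_add_left ?_]
    · rw [← setLIntegral_const]
      refine lintegral_congr fun z => ?_
      rw [hh]
      dsimp only
      rw [← ENNReal.ofReal_add (by linarith [min_le_right (‖z - x‖ ^ 2) (2 * ρ ^ 2)]) (le_min (by positivity) (by positivity)),
        sub_add_cancel]
    · exact (measurable_const.sub (((measurable_id.sub_const x).norm.pow_const 2).min measurable_const)).ennreal_ofReal
  have hmin_le : ∫⁻ z in A, ENNReal.ofReal (min (‖z - x‖ ^ 2) (2 * ρ ^ 2)) ≤ ∫⁻ z in A, ENNReal.ofReal (‖z - x‖ ^ 2) :=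
    lintegral_mono fun z => ENNReal.ofReal_le_ofReal (min_le_left _ _)
  have hmin_ball : ∫⁻ z in ball x ρ, ENNReal.ofReal (min (‖z - x‖ ^ 2) (2 * ρ ^ 2)) = ∫⁻ z in ball x ρ, ENNReal.ofReal (‖z - x‖ ^ 2) := by
    refine setLIntegral_congr_fun measurableSet_ball fun z hz => ?_
    have hzx : ‖z - x‖ < ρ := by rwa [mem_ball, dist_eq_norm] at hz
    rw [min_eq_left]
    nlinarith [norm_nonneg (z - x)]
  -- the algebra in `ℝ≥0∞` (all quantities finite)
  have hA' := hsplit A hA hAfin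
  have hB' := hsplit (ball x ρ) measurableSet_ball hBfin
  rw [hvol] at hA'
  rw [hmin_ball] at hB'
  have hfinA : ∫⁻ z in A, h z ≠ ⊤ := by
    refine (lt_of_le_of_lt (le_self_add) (lt_of_le_of_lt (le_of_eq hA') ?_)).ne
    exact ENNReal.mul_lt_top ENNReal.ofReal_lt_top hBfin.lt_top
  have hfinB : ∫⁻ z in ball x ρ, h z ≠ ⊤ := by
    refine (lt_of_le_of_lt (le_self_add) (lt_of_le_of_lt (le_of_eq hB') ?_)).ne
    exact ENNReal.mul_lt_top ENNReal.ofReal_lt_top hBfin.lt_top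
  -- from `∫_A h + ∫_A min = ∫_B h + ∫_B r²` and `∫_A h ≤ ∫_B h`: `∫_B r² ≤ ∫_A min ≤ ∫_A r²`
  have key : ∫⁻ z in ball x ρ, ENNReal.ofReal (‖z - x‖ ^ 2) ≤ ∫⁻ z in A, ENNReal.ofReal (min (‖z - x‖ ^ 2) (2 * ρ ^ 2)) := by
    have e : (∫⁻ z in A, h z) + ∫⁻ z in A, ENNReal.ofReal (min (‖z - x‖ ^ 2) (2 * ρ ^ 2)) =
        (∫⁻ z in ball x ρ, h z) + ∫⁻ z in ball x ρ, ENNReal.ofReal (‖z - x‖ ^ 2) := by rw [hA', hB']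
    by_contra hlt
    rw [not_le] at hlt
    have : (∫⁻ z in A, h z) + ∫⁻ z in A, ENNReal.ofReal (min (‖z - x‖ ^ 2) (2 * ρ ^ 2)) <
        (∫⁻ z in ball x ρ, h z) + ∫⁻ z in ball x ρ, ENNReal.ofReal (‖z - x‖ ^ 2) :=
      ENNReal.add_lt_add_of_le_of_lt hfinA hex hlt
    exact this.ne e
  exact key.trans hmin_le

/-- **THE PLANAR BATHTUB INEQUALITY** (`ℝ≥0∞` form): `|A|² ≤ 2π ∫_A |z − x|²` for every measurable `A ⊆ ℝ²` of finite measure and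
every centre `x`. [cite: LiebLoss2001, Theorem 1.14 (bathtub principle)] -/
theorem sq_volume_le_lintegral_norm_sq {A : Set (EuclideanSpace ℝ (Fin 2))} (hA : MeasurableSet A) (hAfin : volume A ≠ ⊤)
    (x : EuclideanSpace ℝ (Fin 2)) :
    volume A ^ 2 ≤ ENNReal.ofReal (2 * π) * ∫⁻ z in A, ENNReal.ofReal (‖z - x‖ ^ 2) := by
  -- the disc of the same area
  set m : ℝ := (volume A).toReal with hm
  have hm0 : 0 ≤ m := ENNReal.toReal_nonneg
  set ρ : ℝ := Real.sqrt (m / π) with hρdef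
  have hρ : 0 ≤ ρ := Real.sqrt_nonneg _
  have hρsq : π * ρ ^ 2 = m := by
    rw [hρdef, Real.sq_sqrt (div_nonneg hm0 pi_pos.le)]; field_simp
  have hvol : volume A = volume (ball x ρ) := by
    rw [volume_ball_fin_two_ofReal hρ, hρsq, hm, ENNReal.ofReal_toReal hAfin]
  have h1 := lintegral_ball_norm_sq_le_of_volume_eq hA hρ hvol
  rw [lintegral_ball_norm_sq hρ x] at h1
  calc volume A ^ 2 = ENNReal.ofReal (m ^ 2) := by rw [hm, ENNReal.ofReal_pow hm0, ENNReal.ofReal_toReal hAfin]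
    _ = ENNReal.ofReal (2 * π) * ENNReal.ofReal (π * ρ ^ 4 / 2) := by
        rw [← ENNReal.ofReal_mul (by positivity)]
        congr 1
        rw [← hρsq]; ring
    _ ≤ ENNReal.ofReal (2 * π) * ∫⁻ z in A, ENNReal.ofReal (‖z - x‖ ^ 2) := by gcongr

/-- **THE PLANAR BATHTUB INEQUALITY** (real form): `|A|² ≤ 2π ∫_A |z − x|²` whenever `z ↦ |z − x|²` is integrable on `A`
(e.g. `A` bounded). [cite: LiebLoss2001, Theorem 1.14 (bathtub principle)] -/
theorem sq_volume_real_le_integral_norm_sq {A : Set (EuclideanSpace ℝ (Fin 2))} (hA : MeasurableSet A) (hAfin : volume A ≠ ⊤)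
    (x : EuclideanSpace ℝ (Fin 2)) (hint : IntegrableOn (fun z : EuclideanSpace ℝ (Fin 2) => ‖z - x‖ ^ 2) A) :
    (volume A).toReal ^ 2 ≤ 2 * π * ∫ z in A, ‖z - x‖ ^ 2 := by
  have h := sq_volume_le_lintegral_norm_sq hA hAfin x
  rw [← ofReal_integral_eq_lintegral_ofReal hint (Eventually.of_forall fun z => by positivity),
    ← ENNReal.ofReal_mul (by positivity)] at h
  have h2 : volume A ^ 2 = ENNReal.ofReal ((volume A).toReal ^ 2) := by
    rw [ENNReal.ofReal_pow ENNReal.toReal_nonneg, ENNReal.ofReal_toReal hAfin]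
  rw [h2] at h
  have hnn : 0 ≤ 2 * π * ∫ z in A, ‖z - x‖ ^ 2 :=
    mul_nonneg (by positivity) (setIntegral_nonneg hA fun z _ => by positivity)
  exact (ENNReal.ofReal_le_ofReal_iff hnn).1 h

end Bathtub

end Literature.Analysis.FunctionSpaces

end
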